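import Mathlib
import Summits.RiemannHypothesis.RiemannHypothesis.Theorems.WeilGroundStateGroundStatesConvergeToXiEnergyBddBelow
import Summits.RiemannHypothesis.RiemannHypothesis.Theorems.WeilGroundStateGroundStatesConvergeToXiRHofTight
import Literature.NumberTheory.LFunctions.WeilExplicit
import Literature.NumberTheory.LFunctions.WeilExplicitProofs
import Literature.NumberTheory.LFunctions.WeilGroundEnergyProofs
import Literature.NumberTheory.LFunctions.WeilMellinBounds
import Literature.NumberTheory.LFunctions.WeilCriterionConverse
import Literature.NumberTheory.LFunctions.WeilGroundStateRealZerosProofs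
import Literature.Analysis.Complex.BoundedPowerSums
import HarnessLib

/-!
# Sub-exponential ground energy implies RH; the decay rate bounds the offsets of the zeros
(crux item stmt-RiemannHypothesis-1527 `GroundStatesConvergeToXi`, route
route-RiemannHypothesis-WeilGroundState, line `Sketch`; `--supports`)

`…EnergyBddBelow.lean` proves (E): `ε` BOUNDED BELOW on `a > 0` ⇒ RH.  Here the hypothesis is
weakened from a constant to an exponential:

* `abs_re_sub_half_le_of_weilGroundEnergy_ge_neg_exp` — **if `ε(a) ≥ -K e^{δ a}` for all
  `a > 0` (some `K`, `δ ≥ 0`), then every non-trivial zero has `|Re ρ - 1/2| ≤ δ`.**  The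
  exponential rate at which the ground energy may sink to `-∞` bounds the width of the strip
  occupied by the zeros.
* `riemannHypothesis_of_weilGroundEnergy_subexp` — if `ε(a) ≥ -K_δ e^{δ a}` for EVERY `δ > 0`
  (sub-exponential blow-down), then RH; with the known direction (`RH ⇒ ε ≥ 0`) this is an
  equivalence, `riemannHypothesis_iff_weilGroundEnergy_subexp`.  Contrapositive: under ¬RH with
  a zero at offset `β₀ = |Re ρ₀ - 1/2| > 0`, `limsup_a e^{-δ a} |ε(a)| = ∞` for every `δ < β₀`.

Mechanism (as in (E), with weights): the translate-mix `g + c g_x` lives on the window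
`[-(r + |x|), r + |x|]` (`r` the radius of `supp g`), so the polarisation identity gives
`|B_g(x)| ≤ Re Q(g) + 8 K e^{δ (r + |x|)} ∫|g|²`, i.e. the zero-sum `B_g(x) = Σ_ρ m(ρ) P_g(ρ)
e^{(ρ-1/2)x}` grows at most like `e^{δ|x|}`; an absolutely convergent exponential sum with
locally finite exponents and growth `O(e^{δ|x|})` has no modes with `|Re| > δ`
(`sum_fiber_eq_zero_of_exp_growth`, from the bounded case applied to `e^{-δ x} B_g(±x)`); a bump
with `Re ĝ > 0` on the horizontal line through `ρ₀` makes `P_g(ρ₀) ≠ 0`.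

Used by `…RHofTightGeo.lean`: the line's stub C⁺ (tightness only for `b < 1/2`) along windows of
at most geometric growth gives exactly a sub-exponential lower bound for `ε`, hence RH.
-/

set_option linter.dupNamespace false

noncomputable section

open MeasureTheory Complex Filter Set
open scoped Real Topology ComplexConjugate

namespace Summit.RiemannHypothesis.RiemannHypothesis.Theorems.GroundStatesConvergeToXi

open Literature.NumberTheory.LFunctions

/-! ## Exponential sums of exponential growth -/

/-- **Exponential sums with growth `O(e^{δ|x|})` have no modes with `|Re| > δ`.**  If
`F(x) = Σᵢ cᵢ e^{λᵢ x}` (`Σ ‖cᵢ‖ < ∞`, `|Re λᵢ| ≤ R`, `(λᵢ)` locally finite) satisfies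
`‖F(x)‖ ≤ M e^{δ|x|}` on `ℝ` with `δ ≥ 0`, then the coefficients on every fibre `{i | λᵢ = μ}` with
`|Re μ| > δ` sum to zero: apply the bounded case
(`BoundedPowerSum.sum_fiber_eq_zero_of_exp`) to `e^{-δx} F(x) = Σ cᵢ e^{(λᵢ - δ)x}` on `x ≥ 0`
(for `Re μ > δ`) and to `e^{-δx} F(-x) = Σ cᵢ e^{(-λᵢ - δ)x}` (for `Re μ < -δ`). [folklore] -/
theorem sum_fiber_eq_zero_of_exp_growth {ι : Type*} [Countable ι] {lam c : ι → ℂ} {R : ℝ}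
    (hc : Summable fun i ↦ ‖c i‖) (hR : ∀ i, |(lam i).re| ≤ R)
    (hlf : ∀ z : ℂ, ∃ ε > 0, {i | lam i ∈ Metric.ball z ε}.Finite)
    {δ M : ℝ} (hδ : 0 ≤ δ)
    (hM : ∀ x : ℝ, ‖∑' i, c i * cexp (lam i * x)‖ ≤ M * Real.exp (δ * |x|))
    {μ : ℂ} (hμ : δ < |μ.re|) (s : Finset ι) (hs : ∀ i, i ∈ s ↔ lam i = μ) :
    ∑ i ∈ s, c i = 0 := by
  -- local finiteness of shifted / reflected exponent families
  have hlf_shift : ∀ (σ z : ℂ), (∃ ε > 0, {i | lam i + σ ∈ Metric.ball z ε}.Finite) ∧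
      (∃ ε > 0, {i | -lam i + σ ∈ Metric.ball z ε}.Finite) := by
    intro σ z
    constructor
    · obtain ⟨ε, hε, hfin⟩ := hlf (z - σ)
      refine ⟨ε, hε, hfin.subset fun i hi ↦ ?_⟩
      simp only [mem_setOf_eq, Metric.mem_ball, dist_eq_norm] at hi ⊢
      rwa [show lam i - (z - σ) = lam i + σ - z by ring]
    · obtain ⟨ε, hε, hfin⟩ := hlf (-(z - σ))
      refine ⟨ε, hε, hfin.subset fun i hi ↦ ?_⟩
      simp only [mem_setOf_eq, Metric.mem_ball, dist_eq_norm] at hi ⊢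
      rwa [show lam i - -(z - σ) = -(-lam i + σ - z) by ring, norm_neg]
  -- the weight `e^{-δx}`
  have hw : ∀ x : ℝ, ‖cexp (-((δ : ℂ) * x))‖ = Real.exp (-(δ * x)) := fun x ↦ by
    rw [Complex.norm_exp]
    congr 1
    simp
  rcases lt_abs.1 hμ with hμ | hμ
  · -- `Re μ > δ`: shift the exponents by `-δ`
    refine Literature.Analysis.Complex.BoundedPowerSum.sum_fiber_eq_zero_of_exp
      (lam := fun i ↦ lam i - δ) (R := R) (M := M) hc
      (fun i ↦ by
        rw [sub_re, Complex.ofReal_re]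
        linarith [(le_abs_self _).trans (hR i)])
      (fun z ↦ by
        simpa [sub_eq_add_neg] using (hlf_shift (-(δ : ℂ)) z).1)
      (fun x hx ↦ ?_) (μ := μ - δ) (by rw [sub_re, Complex.ofReal_re]; linarith) s
      (fun i ↦ by rw [hs i, sub_left_inj])
    have e : ∑' i, c i * cexp ((lam i - δ) * x) =
        cexp (-((δ : ℂ) * x)) * ∑' i, c i * cexp (lam i * x) := by
      rw [← tsum_mul_left]
      refine tsum_congr fun i ↦ ?_
      rw [show (lam i - δ) * (x : ℂ) = -((δ : ℂ) * x) + lam i * x by ring, Complex.exp_add]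
      ring
    rw [e, norm_mul, hw]
    calc Real.exp (-(δ * x)) * ‖∑' i, c i * cexp (lam i * x)‖
        ≤ Real.exp (-(δ * x)) * (M * Real.exp (δ * |x|)) :=
          mul_le_mul_of_nonneg_left (hM x) (Real.exp_pos _).le
      _ = M := by
          rw [abs_of_nonneg hx, mul_comm, mul_assoc, ← Real.exp_add, add_neg_cancel,
            Real.exp_zero, mul_one]
  · -- `Re μ < -δ`: reflect and shift
    refine Literature.Analysis.Complex.BoundedPowerSum.sum_fiber_eq_zero_of_exp
      (lam := fun i ↦ -lam i - δ) (R := R) (M := M) hc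
      (fun i ↦ by
        rw [sub_re, neg_re, Complex.ofReal_re]
        linarith [(neg_le_abs _).trans (hR i)])
      (fun z ↦ by
        simpa [sub_eq_add_neg] using (hlf_shift (-(δ : ℂ)) z).2)
      (fun x hx ↦ ?_) (μ := -μ - δ) (by rw [sub_re, neg_re, Complex.ofReal_re]; linarith) s
      (fun i ↦ by rw [hs i, sub_left_inj, neg_inj])
    have e : ∑' i, c i * cexp ((-lam i - δ) * x) =
        cexp (-((δ : ℂ) * x)) * ∑' i, c i * cexp (lam i * ((-x : ℝ) : ℂ)) := by
      rw [← tsum_mul_left]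
      refine tsum_congr fun i ↦ ?_
      rw [show (-lam i - δ) * (x : ℂ) = -((δ : ℂ) * x) + lam i * ((-x : ℝ) : ℂ) by push_cast; ring,
        Complex.exp_add]
      ring
    rw [e, norm_mul, hw]
    calc Real.exp (-(δ * x)) * ‖∑' i, c i * cexp (lam i * ((-x : ℝ) : ℂ))‖
        ≤ Real.exp (-(δ * x)) * (M * Real.exp (δ * |(-x : ℝ)|)) :=
          mul_le_mul_of_nonneg_left (hM (-x)) (Real.exp_pos _).le
      _ = M := by
          rw [abs_neg, abs_of_nonneg hx, mul_comm, mul_assoc, ← Real.exp_add, add_neg_cancel,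
            Real.exp_zero, mul_one]

/-! ## The window of the translate-mix -/

/-- The translate-mix `g + c g_x` of a test function supported in `[-r, r]` is supported in
`[-(r + |x|), r + |x|]`. [folklore] -/
theorem tsupport_translateMix_subset {g : ℝ → ℂ} {r : ℝ} (hsupp : tsupport g ⊆ Icc (-r) r)
    (c : ℂ) (x : ℝ) :
    tsupport (WeilConverse.translateMix g c x) ⊆ Icc (-(r + |x|)) (r + |x|) := by
  refine closure_minimal (fun t ht ↦ ?_) isClosed_Icc
  by_contra hmem
  apply ht
  have hg0 : ∀ y : ℝ, r < |y| → g y = 0 := fun y hy ↦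
    image_eq_zero_of_notMem_tsupport fun hys ↦ by
      have h := hsupp hys
      rw [mem_Icc] at h
      have : |y| ≤ r := abs_le.2 ⟨h.1, h.2⟩
      linarith
  have ht' : r + |x| < |t| := by
    rw [mem_Icc, not_and_or, not_le, not_le] at hmem
    rcases hmem with h | h
    · rcases le_or_gt 0 t with ht0 | ht0
      · rw [abs_of_nonneg ht0]; linarith
      · rw [abs_of_neg ht0]; linarith
    · exact lt_of_lt_of_le h (le_abs_self t)
  have h1 : g t = 0 := hg0 t (by linarith [abs_nonneg x])
  have h2 : g (t - x) = 0 := hg0 (t - x) (by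
    have := abs_sub_abs_le_abs_sub t x
    linarith)
  simp [WeilConverse.translateMix, weilTranslate, h1, h2]

/-! ## The exponential lower bound transported to the zero side -/

/-- **The lower bound on a window, transported to the zero side**: if `-K e^{δ a} ≤ ε(a)` for all
`a > 0`, then `-K e^{δ a} ∫|f|² ≤ Re Σ_ρ m(ρ) P_f(ρ)` for every test function `f` supported in
`[-a, a]`, `a > 0` (`ε(a) ∫|f|² ≤ Re Q(f)` and `Q(f)` is the zero side, by the explicit formula).
[folklore] -/
theorem energySubexp_mul_integral_le_re {K δ : ℝ}
    (hL : ∀ a : ℝ, 0 < a → -(K * Real.exp (δ * a)) ≤ weilGroundEnergy a) {f : ℝ → ℂ}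
    (hf : IsWeilTest f) {a : ℝ} (ha : 0 < a) (hsupp : tsupport f ⊆ Icc (-a) a) :
    -(K * Real.exp (δ * a)) * ∫ t, ‖f t‖ ^ 2 ≤ (WeilConverse.zeroForm f).re := by
  have h0 : 0 ≤ ∫ t, ‖f t‖ ^ 2 := integral_nonneg fun _ ↦ by positivity
  have hQ : WeilConverse.zeroForm f = weilQuadratic f :=
    tendsto_nhds_unique (WeilConverse.hasWeilZeroSide_zeroForm hf)
      (explicit_formula_holds (hf.weilConv hf.weilReflect))
  rw [hQ]
  calc -(K * Real.exp (δ * a)) * ∫ t, ‖f t‖ ^ 2 ≤ weilGroundEnergy a * ∫ t, ‖f t‖ ^ 2 :=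
        mul_le_mul_of_nonneg_right (hL a ha) h0
    _ ≤ (weilQuadratic f).re := ConnesVanSuijlekom.weilGroundEnergy_mul_le_re hf hsupp

/-- **`|B_g(x)| ≤ Re Q(g) + 8 K e^{δ(r + |x|)} ∫|g|²`** when `-K e^{δ a} ≤ ε(a)` on `a > 0`
(`K, δ ≥ 0`) and `supp g ⊆ [-r, r]`, `r > 0`: expand `Re Q(g + c g_x) ≥ -K e^{δ(r+|x|)} ∫|g + c g_x|²
≥ -4 K e^{δ(r+|x|)} ∫|g|²` with `c = -conj B_g(x)/|B_g(x)|` (the algebra of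
`energyBddBelow_norm_expSum_le`). [folklore] -/
theorem energySubexp_norm_expSum_le {K δ : ℝ} (hK : 0 ≤ K) (hδ : 0 ≤ δ)
    (hL : ∀ a : ℝ, 0 < a → -(K * Real.exp (δ * a)) ≤ weilGroundEnergy a)
    {g : ℝ → ℂ} (hg : IsWeilTest g) {r : ℝ} (hr : 0 < r) (hsupp : tsupport g ⊆ Icc (-r) r)
    (x : ℝ) :
    ‖WeilConverse.expSum g x‖ ≤
      (WeilConverse.zeroForm g).re + 8 * K * Real.exp (δ * (r + |x|)) * ∫ t, ‖g t‖ ^ 2 := by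
  have hI0 : 0 ≤ ∫ t, ‖g t‖ ^ 2 := integral_nonneg fun _ ↦ by positivity
  have hE0 : 0 ≤ K * Real.exp (δ * (r + |x|)) := by positivity
  have hQ := energySubexp_mul_integral_le_re hL hg hr hsupp
  have hQ' : -(K * Real.exp (δ * (r + |x|))) * ∫ t, ‖g t‖ ^ 2 ≤ (WeilConverse.zeroForm g).re := by
    refine le_trans (mul_le_mul_of_nonneg_right (neg_le_neg (mul_le_mul_of_nonneg_left
      (Real.exp_le_exp.2 ?_) hK)) hI0) hQ
    exact mul_le_mul_of_nonneg_left (by linarith [abs_nonneg x]) hδ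
  set B := WeilConverse.expSum g x with hBdef
  by_cases hB : B = 0
  · rw [hB, norm_zero]; nlinarith
  have hA : WeilConverse.expSum' g x = conj B := by
    rw [hBdef, ← WeilConverse.conj_expSum' g x, Complex.conj_conj]
  have hn0 : ‖B‖ ≠ 0 := norm_ne_zero_iff.2 hB
  have hn : (‖B‖ : ℂ) ≠ 0 := by exact_mod_cast hn0
  set c : ℂ := -conj B / (‖B‖ : ℂ) with hc
  have hcB : c * B = -(‖B‖ : ℂ) := by
    rw [hc, div_mul_eq_mul_div, neg_mul, Complex.conj_mul', neg_div]
    congr 1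
    rw [sq, mul_div_assoc, div_self hn, mul_one]
  have hcn : ‖c‖ = 1 := by
    rw [hc, norm_div, norm_neg, Complex.norm_conj, Complex.norm_real, Real.norm_eq_abs, abs_norm,
      div_self hn0]
  have hc1 : Complex.normSq c = 1 := by
    rw [Complex.normSq_eq_norm_sq, hcn, one_pow]
  have hrx : 0 < r + |x| := by positivity
  have h0 := energySubexp_mul_integral_le_re hL (WeilConverse.isWeilTest_translateMix hg c x) hrx
    (tsupport_translateMix_subset hsupp c x)
  have h4 := energyBddBelow_integral_norm_sq_translateMix_le hg hcn.le x
  have h5 : -(K * Real.exp (δ * (r + |x|))) * (4 * ∫ t, ‖g t‖ ^ 2) ≤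
      -(K * Real.exp (δ * (r + |x|))) * ∫ t, ‖WeilConverse.translateMix g c x t‖ ^ 2 :=
    mul_le_mul_of_nonpos_left h4 (by linarith)
  rw [WeilConverse.zeroForm_translateMix hg c x, hA, ← map_mul, hcB, hc1] at h0
  simp only [map_neg, Complex.conj_ofReal, Complex.ofReal_one, one_mul, add_re, neg_re,
    Complex.ofReal_re] at h0
  have hKEN : 0 ≤ K * Real.exp (δ * (r + |x|)) * ∫ t, ‖g t‖ ^ 2 := mul_nonneg hE0 hI0
  linarith

/-! ## No modes beyond the rate -/

/-- **No zero-sum modes with offset `> δ`**: if `-K e^{δa} ≤ ε(a)` on `a > 0` (`K, δ ≥ 0`), then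
`m(ρ₀) P_g(ρ₀) = 0` for every test function `g` and every non-trivial zero `ρ₀` with
`|Re ρ₀ - 1/2| > δ` (`sum_fiber_eq_zero_of_exp_growth` applied to `B_g`, whose growth is
`O(e^{δ|x|})` by `energySubexp_norm_expSum_le`). [folklore] -/
theorem energySubexp_order_mul_pairCoeff_eq_zero {K δ : ℝ} (hK : 0 ≤ K) (hδ : 0 ≤ δ)
    (hL : ∀ a : ℝ, 0 < a → -(K * Real.exp (δ * a)) ≤ weilGroundEnergy a)
    {g : ℝ → ℂ} (hg : IsWeilTest g) {ρ₀ : ℂ} (hρ₀ : ρ₀ ∈ ZetaZeros.riemannZetaNontrivialZeros)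
    (hre : δ < |ρ₀.re - 1 / 2|) :
    (riemannZetaZeroOrder ρ₀ : ℂ) * WeilConverse.pairCoeff g ρ₀ = 0 := by
  obtain ⟨r, hr1, hsupp⟩ := energyBddBelow_exists_tsupport_subset hg
  have hr : 0 < r := by linarith
  set Q₀ : ℝ := (WeilConverse.zeroForm g).re with hQ₀
  set N₀ : ℝ := ∫ t, ‖g t‖ ^ 2 with hN₀
  have hN₀0 : 0 ≤ N₀ := integral_nonneg fun _ ↦ by positivity
  -- growth bound `‖B_g(x)‖ ≤ (max Q₀ 0 + 8 K e^{δ r} N₀) e^{δ |x|}`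
  have hM : ∀ x : ℝ, ‖∑' ρ : ZetaZeros.riemannZetaNontrivialZeros,
      (riemannZetaZeroOrder (ρ : ℂ) : ℂ) * WeilConverse.pairCoeff g ρ *
        cexp (((ρ : ℂ) - 1 / 2) * x)‖ ≤
      (max Q₀ 0 + 8 * K * Real.exp (δ * r) * N₀) * Real.exp (δ * |x|) := by
    intro x
    have h := energySubexp_norm_expSum_le hK hδ hL hg hr hsupp x
    rw [WeilConverse.expSum] at h
    refine h.trans ?_
    have h1 : 1 ≤ Real.exp (δ * |x|) := Real.one_le_exp (by positivity)
    have h2 : Q₀ ≤ max Q₀ 0 * Real.exp (δ * |x|) :=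
      (le_max_left _ _).trans (le_mul_of_one_le_right (le_max_right _ _) h1)
    have h3 : 8 * K * Real.exp (δ * (r + |x|)) * N₀ =
        8 * K * Real.exp (δ * r) * N₀ * Real.exp (δ * |x|) := by
      rw [mul_add, Real.exp_add]; ring
    rw [h3, add_mul]
    exact add_le_add h2 le_rfl
  have h := sum_fiber_eq_zero_of_exp_growth
    (ι := ZetaZeros.riemannZetaNontrivialZeros)
    (c := fun ρ ↦ (riemannZetaZeroOrder (ρ : ℂ) : ℂ) * WeilConverse.pairCoeff g ρ)
    (lam := fun ρ ↦ (ρ : ℂ) - 1 / 2) (R := 1 / 2)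
    (WeilConverse.summable_norm_pairCoeff hg) (fun ρ ↦ WeilConverse.abs_re_sub_half_le ρ.2)
    (fun z ↦ ?_) hδ hM (μ := ρ₀ - 1 / 2)
    (by simpa [sub_re] using hre) {⟨ρ₀, hρ₀⟩} (fun ρ ↦ ?_)
  · simpa using h
  · refine ⟨1, one_pos, ?_⟩
    refine ((riemannZetaNontrivialZeros_finite_inter_ball (z + 1 / 2) 1).preimage
      (Subtype.val_injective.injOn)).subset fun ρ hρ ↦ ?_
    simp only [mem_setOf_eq, Metric.mem_ball, dist_eq_norm] at hρ
    refine ⟨ρ.2, ?_⟩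
    rw [Metric.mem_ball, dist_eq_norm]
    rwa [show (ρ : ℂ) - (z + 1 / 2) = (ρ : ℂ) - 1 / 2 - z by ring]
  · rw [Finset.mem_singleton, sub_left_inj]
    constructor
    · rintro rfl; rfl
    · intro h; exact Subtype.ext h

/-- **The decay rate of the ground energy bounds the offsets of the zeros.**  If for some `K` and
`δ ≥ 0` the ground energy satisfies `ε(a) ≥ -K e^{δ a}` for all `a > 0`, then every non-trivial
zero `ρ` of `ζ` has `|Re ρ - 1/2| ≤ δ`: choose a bump `g` with `Re ĝ > 0` on the horizontal line
through `ρ` (`exists_isWeilTest_re_weilMellin_pos`), so `m(ρ) P_g(ρ) ≠ 0`, contradicting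
`energySubexp_order_mul_pairCoeff_eq_zero` if `|Re ρ - 1/2| > δ`. [folklore] -/
theorem abs_re_sub_half_le_of_weilGroundEnergy_ge_neg_exp {K δ : ℝ} (hδ : 0 ≤ δ)
    (hL : ∀ a : ℝ, 0 < a → -(K * Real.exp (δ * a)) ≤ weilGroundEnergy a)
    {ρ : ℂ} (hρ : ρ ∈ ZetaZeros.riemannZetaNontrivialZeros) : |ρ.re - 1 / 2| ≤ δ := by
  -- replace `K` by `max K 0 ≥ 0`
  have hL' : ∀ a : ℝ, 0 < a → -(max K 0 * Real.exp (δ * a)) ≤ weilGroundEnergy a := fun a ha ↦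
    le_trans (neg_le_neg (mul_le_mul_of_nonneg_right (le_max_left _ _) (Real.exp_pos _).le))
      (hL a ha)
  by_contra hre
  rw [not_le] at hre
  obtain ⟨g, hg, hpos⟩ := exists_isWeilTest_re_weilMellin_pos ρ.im
  have h := energySubexp_order_mul_pairCoeff_eq_zero (le_max_right _ _) hδ hL' hg hρ hre
  have hm : (riemannZetaZeroOrder ρ : ℂ) ≠ 0 := by
    have := ZetaZeros.riemannZetaNontrivialZeros.one_le_order hρ
    exact_mod_cast (by omega : riemannZetaZeroOrder ρ ≠ 0)
  have h1 : weilMellin g ρ ≠ 0 := by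
    intro h0
    have := hpos ρ.re
    rw [show (ρ.re : ℂ) + ρ.im * I = ρ from Complex.re_add_im ρ, h0, Complex.zero_re] at this
    exact lt_irrefl _ this
  have h2 : weilMellin g (1 - conj ρ) ≠ 0 := by
    intro h0
    have := hpos (1 - ρ.re)
    rw [show ((1 - ρ.re : ℝ) : ℂ) + ρ.im * I = 1 - conj ρ from ?_, h0, Complex.zero_re] at this
    · exact lt_irrefl _ this
    · apply Complex.ext <;> simp
  exact (mul_ne_zero hm (mul_ne_zero h1 ((map_ne_zero _).2 h2))) h

/-- **Sub-exponential ground energy ⇒ RH.**  If for every `δ > 0` there is `K` with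
`ε(a) ≥ -K e^{δ a}` for all `a > 0` — the ground energy of Weil's truncated form does not sink
to `-∞` at any exponential rate — then the Riemann hypothesis holds: every non-trivial zero has
`|Re ρ - 1/2| ≤ δ` for all `δ > 0` (`abs_re_sub_half_le_of_weilGroundEnergy_ge_neg_exp`), hence
lies on the line; `riemannHypothesis_iff_strip_holds` converts to Mathlib's `RiemannHypothesis`.
Strengthens (E) `riemannHypothesis_of_weilGroundEnergy_bddBelow` (the case `δ = 0`). -/
theorem riemannHypothesis_of_weilGroundEnergy_subexp
    (h : ∀ δ : ℝ, 0 < δ → ∃ K : ℝ, ∀ a : ℝ, 0 < a → -(K * Real.exp (δ * a)) ≤ weilGroundEnergy a) :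
    RiemannHypothesis := by
  refine riemannHypothesis_iff_strip_holds.2 fun s hs h0 h1 ↦ ?_
  have hρ := ZetaZeros.riemannZetaNontrivialZeros.mem_iff'.2 ⟨hs, h0, h1⟩
  have hall : ∀ δ : ℝ, 0 < δ → |s.re - 1 / 2| ≤ δ := fun δ hδ ↦ by
    obtain ⟨K, hK⟩ := h δ hδ
    exact abs_re_sub_half_le_of_weilGroundEnergy_ge_neg_exp hδ.le hK hρ
  have h0' : |s.re - 1 / 2| ≤ 0 := le_of_forall_pos_le_add fun δ hδ ↦ by
    simpa using hall δ hδ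
  have := abs_nonpos_iff.1 h0'
  linarith

/-- **RH ⟺ the ground energy is sub-exponential**: `RiemannHypothesis ↔ ∀ δ > 0, ∃ K, ∀ a > 0,
-K e^{δa} ≤ ε(a)` (`→`: under RH `ε ≥ 0`, `riemannHypothesis_iff_weilGroundEnergy_bddBelow`).
Contrapositive reading: RH fails iff `ε(a) ≤ -K e^{δ a}` infinitely often for some `δ > 0` and
every `K` — the ground energy sinks exponentially. -/
theorem riemannHypothesis_iff_weilGroundEnergy_subexp :
    RiemannHypothesis ↔
      ∀ δ : ℝ, 0 < δ → ∃ K : ℝ, ∀ a : ℝ, 0 < a → -(K * Real.exp (δ * a)) ≤ weilGroundEnergy a := by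
  refine ⟨fun hRH δ _ ↦ ?_, riemannHypothesis_of_weilGroundEnergy_subexp⟩
  obtain ⟨L, hL⟩ := riemannHypothesis_iff_weilGroundEnergy_bddBelow.1 hRH
  refine ⟨max (-L) 0, fun a ha ↦ le_trans ?_ (hL a ha)⟩
  have h1 : 1 ≤ Real.exp (δ * a) := Real.one_le_exp (by positivity)
  nlinarith [le_max_left (-L) 0, le_max_right (-L) 0]

end Summit.RiemannHypothesis.RiemannHypothesis.Theorems.GroundStatesConvergeToXi

end
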